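import Summits.BirchSwinnertonDyer.BirchSwinnertonDyer.Theorems.ByReductionTypeAtTwoAnalyticMuFlatPackage
import Summits.BirchSwinnertonDyer.BirchSwinnertonDyer.Theorems.ByReductionTypeAtTwoKatoFreeSandwichMeasureDepth
import Summits.BirchSwinnertonDyer.BirchSwinnertonDyer.Theorems.ConjSpanGenAllLevels
import Summits.BirchSwinnertonDyer.BirchSwinnertonDyer.Theorems.PrintX8VerticalStevensPeriods
import Summits.BirchSwinnertonDyer.BirchSwinnertonDyer.Theorems.ManinLocalTwoThreePrimeClassGeneration
import Literature.NumberTheory.Automorphic.CongruenceSubgroupPropertySL2AwayHolds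
import Literature.NumberTheory.EllipticCurves.Rank1Residual.CyclotomicWindingSpan
import Literature.NumberTheory.EllipticCurves.PAdicLFunctionDistributionHoldsProofs
import Summits.BirchSwinnertonDyer.BirchSwinnertonDyer.Theorems.ResidualThetaTransportAtTwoSignedMuVanishingAtTwoPlusCuspSpanHecke
import HarnessLib

/-!
# Route `ByReductionTypeAtTwo` (K4), crux `OrdMissingLowerBoundAtTwo` (stmt-BirchSwinnertonDyer-19577), line
# `kato-free-lower-sandwich-two` — S3 (flat ⟹ EISENSTEIN) ported to `Theorems/`, the cusp ↔ `Γ₀(N)` dictionary, and the glue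
# «measure depth ⟹ period descent» ⟸ (α) span residual ∧ (β) Eisenstein descent (`--supports`, helper; prepares skeleton v7)

Cell `bsd-2adic`, lead `cruxlead-stmt-BirchSwinnertonDyer-19577` (g0).  THEOREMS ONLY — no definition, no named fact, no
`sorry`; closes nothing; BSD is not proved by any of this.

* §1 `factorsThroughD_of_conjSpanGen`, `exists_eisenstein_of_flat_functional` — the crux-dir sketch's S3
  (`Cruxes/OrdMissingLowerBoundAtTwo/SketchOddPointShimuraDescentTwo.lean` §2, ideator 2/2) PORTED with spelled statements
  (no local `def`s): a `q`-flat integer period functional `m` (`re{∞,γ∞}_f = m(γ)·Ω⁺_f/2`, `m(γ) ≡ k·sl` when `|d(γ)| = 2ᵏ`) is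
  Eisenstein mod `q` (`m ≡ χ∘(d mod N)`), granted `ConjSpanGen N (2^{ord sl})`; `conjSpanGen_two_pow_addOrderOf_of_dvd_four`:
  for `ord sl ∣ 4` that input is THEOREM B (`ConjSpanGenAllLevels.conjSpanGenAll_of_vaserstein_away` with the tree theorem
  `SL2Rel.Away.relG_le_relE_span_natCast`, unconditional, used in-proof) for `P = 2` and the residual (α) for `P = 4, 16`.
* §2 `functional_eq_two_mul_ratPlusSymbol_sub` — the dictionary `m(γ) = 2([b/d]⁺ − [0]⁺)` (`{∞,γ∞} = {∞,b/d} − {∞,0}`,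
  `ManinLocalTwoThree.cuspSymbol_eq_modularSymbol_div_sub`; `re{∞,r} = Ω⁺_f·[r]⁺`).
* §3 `periodDescentOfMeasureDepth_of_eisensteinDescent` — the body of skeleton v6's research stub
  `stub_periodDescentOfMeasureDepth` FROM (α) «`ConjSpanGen N 4 ∧ ConjSpanGen N 16` for odd `N`» and (β) S4 «an integer period
  functional of the optimal newform Eisenstein mod `2^{s+1}` ⟹ a class member `s+1` steps up the 2-adic period tower», through S2
  complete (`…AnalyticMuFlatPackage`, p658737) + §2 + §1.  With this, skeleton v7's research stub is S4 EXACTLY.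

References: Ju. I. Manin, Izv. 1972, Prop. 1.4; G. Stevens, *Arithmetic on Modular Curves* (1982), §1.1; B. Mazur, J. Tate,
J. Teitelbaum, Invent. Math. 84 (1986), §I.8–I.10; L. Vaserstein 1972 (SL₂ over ℤ[1/m]).
-/

set_option linter.dupNamespace false
set_option autoImplicit false

noncomputable section

namespace Summit.BirchSwinnertonDyer.BirchSwinnertonDyer.Theorems.AnalyticMuTwo

open scoped MatrixGroups ModularForm
open CongruenceSubgroup WeierstrassCurve Literature.NumberTheory.EllipticCurves
  Literature.NumberTheory.EllipticCurves.ModularForms Literature.NumberTheory.EllipticCurves.Rank1Residual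
  Literature.NumberTheory.Automorphic
  Summit.BirchSwinnertonDyer.BirchSwinnertonDyer.Theorems.PrintX8VerticalStevens

section Span

/-- **Generic span criterion** (the crux-dir sketch's `factorsThroughD_of_conjSpanGen`, = the tree's
`criterion'_of_conjSpanGen` with `2 ↦ P`, `ZMod 2 ↦ A`): under `ConjSpanGen N P`, a homomorphism `Γ₀(N) → A` (`A` abelian)
killing finite-order, trace-`±2` and `|d| = Pᵐ` elements is a function of `d mod N`. [cite: Manin1972, Prop. 1.4]
[cite: Stevens1982, §1.1] -/
theorem factorsThroughD_of_conjSpanGen {N P : ℕ} {A : Type*} [CommGroup A] (h : ConjSpanGen N P)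
    (κ : Gamma0 N →* A) (hfin : ∀ γ : Gamma0 N, IsOfFinOrder γ → κ γ = 1)
    (htr : ∀ γ : Gamma0 N, trEntry γ = 2 ∨ trEntry γ = -2 → κ γ = 1)
    (hgood : ∀ γ : Gamma0 N, IsGoodAt P γ → κ γ = 1) :
    ∃ χ : ZMod N → A, ∀ γ : Gamma0 N, κ γ = χ (Gamma0Map N γ) := by
  classical
  have hker : spanSubgroup N P ≤ κ.ker := by
    rw [spanSubgroup]
    refine sup_le ?_ (Abelianization.commutator_subset_ker κ)
    rw [Subgroup.closure_le]
    intro γ hγ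
    simp only [spanGenerators, Set.mem_setOf_eq] at hγ
    rw [SetLike.mem_coe, MonoidHom.mem_ker]
    rcases hγ with hg | hf | ht | ht
    · exact hgood γ hg
    · exact hfin γ hf
    · exact htr γ (Or.inl ht)
    · exact htr γ (Or.inr ht)
  have hΓ₁ : ∀ γ : Gamma0 N, γ ∈ Gamma1' N → κ γ = 1 := fun γ hγ =>
    (MonoidHom.mem_ker).1 (hker ((conjSpanGen_iff_gamma1 N P).1 h γ hγ))
  refine ⟨fun x => if hx : ∃ γ : Gamma0 N, Gamma0Map N γ = x then κ hx.choose else 1, fun γ => ?_⟩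
  have hx : ∃ γ' : Gamma0 N, Gamma0Map N γ' = Gamma0Map N γ := ⟨γ, rfl⟩
  dsimp only
  rw [dif_pos hx]
  set c : Gamma0 N := hx.choose with hc_def
  have hc : Gamma0Map N c = Gamma0Map N γ := hx.choose_spec
  have e1 : Gamma0Map N (γ * c⁻¹) * Gamma0Map N c = Gamma0Map N γ := by
    rw [← map_mul, inv_mul_cancel_right]
  have e2 : Gamma0Map N c * Gamma0Map N c⁻¹ = 1 := by
    rw [← map_mul, mul_inv_cancel, map_one]
  have hmem : γ * c⁻¹ ∈ Gamma1' N := by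
    rw [Gamma1_mem']
    calc Gamma0Map N (γ * c⁻¹)
        = Gamma0Map N (γ * c⁻¹) * (Gamma0Map N c * Gamma0Map N c⁻¹) := by rw [e2, mul_one]
      _ = Gamma0Map N γ * Gamma0Map N c⁻¹ := by rw [← mul_assoc, e1]
      _ = Gamma0Map N c * Gamma0Map N c⁻¹ := by rw [hc]
      _ = 1 := e2
  have hκ : κ (γ * c⁻¹) = 1 := hΓ₁ _ hmem
  rw [map_mul, map_inv, mul_inv_eq_one] at hκ
  exact hκ

variable {N : ℕ} [NeZero N] (f : CuspForm (Gamma0 N) 2)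

/-- **S3 (crux-dir sketch `eisenstein_of_multiFlat`, ported): a `q`-FLAT integer period functional of slope `sl` is EISENSTEIN
mod `q`, granted `ConjSpanGen N (2^{ord sl})`.**  `m : Γ₀(N) → ℤ` with `re{∞,γ∞}_f = m(γ)·Ω⁺_f/2` (an integer period
functional; `Ω⁺_f ≠ 0`), `m(γ) ≡ k·sl (mod q)` whenever `|d(γ)| = 2ᵏ`: then `m ≡ χ∘(d mod N)` for some `χ : ℤ/N → ℤ/q`.
(`m` is additive by Manin's `cuspSymbol_mul`, kills finite-order and trace-`±2` elements, and kills the good elements for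
`P = 2^{ord sl}` since `|d| = P^j = 2^{ord sl·j}` gives `m ≡ (ord sl·j)·sl = 0`.) [cite: Manin1972, Prop. 1.4] [cite: Stevens1982, §1.1] -/
theorem exists_eisenstein_of_flat_functional {m : Gamma0 N → ℤ}
    (hm : ∀ γ : Gamma0 N, (cuspSymbol f γ).re = m γ * (plusPeriod f / 2)) (hΩ : plusPeriod f ≠ 0)
    {q : ℕ} (sl : ZMod q) (hflat : ∀ (γ : Gamma0 N) (k : ℕ), (dEntry γ).natAbs = 2 ^ k → ((m γ : ℤ) : ZMod q) = (k : ZMod q) * sl)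
    (hspan : ConjSpanGen N (2 ^ addOrderOf sl)) :
    ∃ χ : ZMod N → ZMod q, ∀ γ : Gamma0 N, ((m γ : ℤ) : ZMod q) = χ (Gamma0Map N γ) := by
  have hΩ2 : plusPeriod f / 2 ≠ 0 := div_ne_zero hΩ two_ne_zero
  -- additivity and vanishing from `cuspSymbol`
  have hmul : ∀ γ δ : Gamma0 N, m (γ * δ) = m γ + m δ := by
    intro γ δ
    have h := hm (γ * δ)
    rw [cuspSymbol_mul_holds f γ δ, Complex.add_re, hm γ, hm δ, ← add_mul] at h
    exact_mod_cast (mul_right_cancel₀ hΩ2 h).symm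
  have hzero : ∀ γ : Gamma0 N, cuspSymbol f γ = 0 → m γ = 0 := by
    intro γ h0
    have h := hm γ
    rw [h0, Complex.zero_re] at h
    have : (m γ : ℝ) = 0 := by
      rcases mul_eq_zero.1 h.symm with h1 | h1
      · exact h1
      · exact absurd h1 hΩ2
    exact_mod_cast this
  have hone : m 1 = 0 := hzero 1 (cuspSymbol_one f)
  -- the functional as a homomorphism to `Multiplicative (ZMod q)`
  let κ : Gamma0 N →* Multiplicative (ZMod q) :=
    { toFun := fun γ => Multiplicative.ofAdd (((m γ : ℤ) : ZMod q))
      map_one' := by simp [hone]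
      map_mul' := fun γ δ => by rw [hmul γ δ, ← ofAdd_add]; push_cast; rfl }
  have hκ : ∀ γ, κ γ = Multiplicative.ofAdd (((m γ : ℤ) : ZMod q)) := fun _ => rfl
  have hfin : ∀ γ : Gamma0 N, IsOfFinOrder γ → κ γ = 1 := by
    intro γ hγ
    rw [hκ, hzero γ (cuspSymbol_eq_zero_of_isOfFinOrder f hγ)]
    simp
  have htr : ∀ γ : Gamma0 N, trEntry γ = 2 ∨ trEntry γ = -2 → κ γ = 1 := by
    intro γ hγ
    rw [hκ, hzero γ (cuspSymbol_eq_zero_of_trEntry f hγ)]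
    simp
  have hgood : ∀ γ : Gamma0 N, IsGoodAt (2 ^ addOrderOf sl) γ → κ γ = 1 := by
    rintro γ ⟨j, hj⟩
    rw [← pow_mul] at hj
    rw [hκ, hflat γ _ hj]
    have h0 : ((addOrderOf sl * j : ℕ) : ZMod q) * sl = 0 := by
      rw [← nsmul_eq_mul]
      exact (addOrderOf_dvd_iff_nsmul_eq_zero).1 (dvd_mul_right _ _)
    rw [h0]
    rfl
  obtain ⟨χ, hχ⟩ := factorsThroughD_of_conjSpanGen hspan κ hfin htr hgood
  refine ⟨fun x => Multiplicative.toAdd (χ x), fun γ => ?_⟩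
  have := hχ γ
  rw [hκ] at this
  show ((m γ : ℤ) : ZMod q) = Multiplicative.toAdd (χ (Gamma0Map N γ))
  rw [← this]
  rfl

omit [NeZero N] in
/-- **S3 at the depths that occur**: the slope has additive order dividing `4` (S2), so only `P ∈ {1·?, 2, 4}` occur:
`addOrderOf sl ∣ 4` ⟹ `2^{ord sl} ∈ {2, 4, 16}` (order `1` gives `P = 2`, order `2` gives `P = 4`, order `4` gives `P = 16`);
`P = 2` is THEOREM B (unconditional, `ConjSpanGenAllLevels.conjSpanGenAll_of_vaserstein_away`), `P = 4, 16` are the span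
residual (α). [cite: Manin1972, Prop. 1.4] [cite: Vaserstein1972SL2, Theorem (p. 313)] -/
theorem conjSpanGen_two_pow_addOrderOf_of_dvd_four (hN : ¬ 2 ∣ N) (h4 : ConjSpanGen N 4) (h16 : ConjSpanGen N 16)
    {q : ℕ} (sl : ZMod q) (hsl : addOrderOf sl ∣ 4) : ConjSpanGen N (2 ^ addOrderOf sl) := by
  have hB : ConjSpanGen N 2 :=
    ConjSpanGenAllLevels.conjSpanGenAll_of_vaserstein_away SL2Rel.Away.relG_le_relE_span_natCast N 2 Nat.prime_two hN
  have hle : addOrderOf sl ≤ 4 := Nat.le_of_dvd (by norm_num) hsl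
  interval_cases h : addOrderOf sl
  · exact absurd hsl (by decide)
  · simpa using hB
  · simpa using h4
  · exact absurd hsl (by decide)
  · simpa using h16

end Span

/-! ## The dictionary: the integer period functional on the 2-power cusps -/

section Dictionary

variable {N : ℕ} [NeZero N] {f : CuspForm (Gamma0 N) 2}

/-- **`m(γ) = 2([b/d]⁺ − [0]⁺)`**: for a rational normalised newform `f` and `γ = (a b; c d) ∈ Γ₀(N)`, `d ≠ 0`, the integer
period functional `m` (`re{∞,γ∞}_f = m(γ)·Ω⁺_f/2`) is the doubled winding class at the cusp `b/d`:
`{∞, γ∞} = {∞, b/d} − {∞, 0}` (`cuspSymbol_eq_modularSymbol_div_sub`) and `re{∞, r} = Ω⁺_f·[r]⁺`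
(`plusSymbol_eq_re_holds`, `ratCast_ratPlusSymbol_holds`). [cite: Manin1972, Prop. 1.4 / Thm. 1.6] [cite: MazurTateTeitelbaum1986Invent, §I.8] -/
theorem functional_eq_two_mul_ratPlusSymbol_sub (hf : IsNewform0 f) (hQ : coeffField f = ⊥) (hΩ : plusPeriod f ≠ 0)
    {m : Gamma0 N → ℤ} (hm : ∀ γ : Gamma0 N, (cuspSymbol f γ).re = m γ * (plusPeriod f / 2))
    (γ : Gamma0 N) (hd : dEntry γ ≠ 0) :
    (m γ : ℚ) = 2 * (ratPlusSymbol f ((((γ : SL(2, ℤ)) 0 1 : ℤ) : ℚ) / ((dEntry γ : ℤ) : ℚ)) - ratPlusSymbol f 0) := by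
  have hreal : ∀ n, (cuspCoeff f n).im = 0 := cuspCoeff_im_eq_zero_of_coeffField_eq_bot hQ
  have hre : ∀ r : ℚ, (modularSymbol f r).re = plusPeriod f * ratPlusSymbol f r := by
    intro r
    have h1 : plusSymbol f r = ((modularSymbol f r).re : ℂ) := plusSymbol_eq_re_holds f hreal r
    have h2 : (ratPlusSymbol f r : ℝ) = normalizedPlusSymbol f r := ratCast_ratPlusSymbol_holds hf hQ r
    rw [normalizedPlusSymbol, h1, Complex.ofReal_re] at h2
    field_simp at h2
    linarith [h2]
  have h := hm γ
  rw [ManinLocalTwoThree.cuspSymbol_eq_modularSymbol_div_sub f γ hd, Complex.sub_re, hre, hre] at h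
  have hΩ2 : plusPeriod f / 2 ≠ 0 := div_ne_zero hΩ two_ne_zero
  have : (m γ : ℝ) = 2 * ((ratPlusSymbol f ((((γ : SL(2, ℤ)) 0 1 : ℤ) : ℚ) / ((dEntry γ : ℤ) : ℚ)) : ℝ) - (ratPlusSymbol f 0 : ℝ)) := by
    have e : (m γ : ℝ) * (plusPeriod f / 2) = (2 * ((ratPlusSymbol f ((((γ : SL(2, ℤ)) 0 1 : ℤ) : ℚ) / ((dEntry γ : ℤ) : ℚ)) : ℝ) -
        (ratPlusSymbol f 0 : ℝ))) * (plusPeriod f / 2) := by rw [← h]; unfold dEntry; ring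
    exact mul_right_cancel₀ hΩ2 e
  exact_mod_cast this

end Dictionary

/-! ## The glue for skeleton v7: measure depth ⟹ period descent FROM (α) the span residual and (β) S4 -/

section Glue

open Summit.BirchSwinnertonDyer.Rank1Residual
  Literature.NumberTheory.EllipticCurves.Greenberg1999

/-- **v6's research stub from v7's two stubs.**  Granted the span residual (α)
«`ConjSpanGen N 4 ∧ ConjSpanGen N 16` for odd `N`» and (β) S4 «an integer period functional of the optimal newform that is
EISENSTEIN mod `2^{s+1}` (`m ≡ χ∘d`) forces a class member `s+1` steps up the 2-adic period tower», the statement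
«MEASURE DEPTH ⟹ PERIOD DESCENT» (body of `stub_periodDescentOfMeasureDepth`, skeleton v6) follows:  measure depth `s+1`
⟹ (S2, `exists_slope_winding_flat_of_measure_depth` + the level bridge) the winding classes at 2-power cusps are flat of a slope
`sl`, `4·sl = 0` ⟹ (dictionary `functional_eq_two_mul_ratPlusSymbol_sub`) the integer period functional `m` is flat on the
elements with `|d| = 2ᵏ` ⟹ (S3 `exists_eisenstein_of_flat_functional`, span input from THEOREM B / (α) by
`conjSpanGen_two_pow_addOrderOf_of_dvd_four`) `m ≡ χ∘d (mod 2^{s+1})` ⟹ (β) descent.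
[cite: MazurTateTeitelbaum1986Invent, §I.10] [cite: Manin1972, Prop. 1.4] [cite: AbbesUllmo1996, Thm. A] -/
theorem periodDescentOfMeasureDepth_of_eisensteinDescent
    (hspan : ∀ N : ℕ, Odd N → ConjSpanGen N 4 ∧ ConjSpanGen N 16)
    (S4 : ∀ (E₀ : WeierstrassCurve ℚ) [E₀.IsElliptic] [E₀.IsGloballyMinimal] [NeZero (E₀.conductorNorm ℤ)]
      (D₀ : ModularParametrizationData E₀ (E₀.conductorNorm ℤ)),
      (∀ z ∈ D₀.L.lattice, ∃ w ∈ periodLattice D₀.f, z = D₀.c * w) →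
      ¬ E₀.HasCM → E₀.analyticRank = 0 → GoodOrd E₀ 2 →
      (∃ (W₁ : WeierstrassCurve ℚ) (_ : W₁.IsElliptic) (_ : W₁.IsGloballyMinimal),
        IsIsogenous E₀ W₁ ∧ ∃ x : ℚ, HasRationalTwoTorsionX W₁ x) →
      ∀ (s : ℕ) (m : Gamma0 (E₀.conductorNorm ℤ) → ℤ),
        (∀ γ, (cuspSymbol D₀.f γ).re = m γ * (plusPeriod D₀.f / 2)) →
      ∀ χ : ZMod (E₀.conductorNorm ℤ) → ZMod (2 ^ (s + 1)),
        (∀ γ, ((m γ : ℤ) : ZMod (2 ^ (s + 1))) = χ (Gamma0Map (E₀.conductorNorm ℤ) γ)) →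
      ∃ (W₃ : WeierstrassCurve ℚ) (_ : W₃.IsElliptic) (_ : W₃.IsGloballyMinimal),
        IsIsogenous E₀ W₃ ∧ ∃ r : ℚ, W₃.realPeriodRat = (r : ℝ) * E₀.realPeriodRat ∧ ((s : ℤ) + 1) ≤ padicValRat 2 r) :
    ∀ (E₀ : WeierstrassCurve ℚ) [E₀.IsElliptic] [E₀.IsGloballyMinimal] [NeZero (E₀.conductorNorm ℤ)]
      (D₀ : ModularParametrizationData E₀ (E₀.conductorNorm ℤ)),
      (∀ z ∈ D₀.L.lattice, ∃ w ∈ periodLattice D₀.f, z = D₀.c * w) →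
      ¬ E₀.HasCM → E₀.analyticRank = 0 → GoodOrd E₀ 2 →
      (∃ (W₁ : WeierstrassCurve ℚ) (_ : W₁.IsElliptic) (_ : W₁.IsGloballyMinimal),
        IsIsogenous E₀ W₁ ∧ ∃ x : ℚ, HasRationalTwoTorsionX W₁ x) →
      ∀ s : ℕ, (∀ (n : ℕ) (b : ZMod (2 ^ (n + 2))), ¬ 2 ∣ b.val →
        ‖2 * msdMeasure D₀.f (unitRoot E₀ 2 : ℚ_[2]) (n + 2) b‖ ≤ (2 : ℝ) ^ (-((s : ℤ) + 1))) →
      ∃ (W₃ : WeierstrassCurve ℚ) (_ : W₃.IsElliptic) (_ : W₃.IsGloballyMinimal),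
        IsIsogenous E₀ W₃ ∧ ∃ r : ℚ, W₃.realPeriodRat = (r : ℝ) * E₀.realPeriodRat ∧ ((s : ℤ) + 1) ≤ padicValRat 2 r := by
  intro E₀ _ _ _ D₀ hopt hcm hr hgo hW₁ s hν
  haveI : Fact (Nat.Prime 2) := ⟨Nat.prime_two⟩
  have hord : IsOrdinaryAt E₀ 2 := hgo
  obtain ⟨hαeq, hαu, hα0⟩ := unitRoot_coe_spec (W := E₀) hord
  have hf := D₀.isNewformOf
  have hQ : coeffField D₀.f = ⊥ := hf.coeffField_eq_bot
  have h2N : ¬ 2 ∣ E₀.conductorNorm ℤ := not_dvd_level_of_isNewformOf hf hord.1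
  have hNodd : Odd (E₀.conductorNorm ℤ) := by
    rcases Nat.even_or_odd (E₀.conductorNorm ℤ) with h | h
    · exact absurd (even_iff_two_dvd.mp h) h2N
    · exact h
  have ha₂ : cuspCoeff D₀.f 2 = ((E₀.frobeniusTrace 2 : ℤ) : ℂ) := cuspCoeff_eq_frobeniusTrace_of_isNewformOf_holds hf hord.1
  have ha₂' : E₀.frobeniusTrace 2 = 1 ∨ E₀.frobeniusTrace 2 = -1 := by
    have hH : E₀.frobeniusTrace 2 ^ 2 ≤ 8 := by
      have h := E₀.frobeniusTrace_sq_le_four_mul 2 hord.1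
      push_cast at h
      linarith
    have hodd : ¬ (2 : ℤ) ∣ E₀.frobeniusTrace 2 := by exact_mod_cast hord.2
    have hb : -2 ≤ E₀.frobeniusTrace 2 ∧ E₀.frobeniusTrace 2 ≤ 2 := by
      constructor <;> nlinarith [hH, sq_nonneg (E₀.frobeniusTrace 2 + 3), sq_nonneg (E₀.frobeniusTrace 2 - 3)]
    omega
  have hroot : (unitRoot E₀ 2 : ℚ_[2]) ^ 2 - (E₀.frobeniusTrace 2 : ℤ) * (unitRoot E₀ 2 : ℚ_[2]) + 2 = 0 := by
    have := hαeq; push_cast at this ⊢; exact this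
  have hB : (0 : ℝ) ≤ (2 : ℝ) ^ (-((s : ℤ) + 1)) := zpow_nonneg (by norm_num) _
  -- S2: flat winding classes at the 2-power cusps
  have hν' := forall_norm_two_mul_msdMeasure_intCast_le_of_levels_two D₀.f (unitRoot E₀ 2 : ℚ_[2])
    (msdMeasure_distribution_of_isNewformOf hord hf) hB (fun n b hb => hν n b hb)
  obtain ⟨sl, h4sl, hflat⟩ := exists_slope_winding_flat_of_measure_depth hf.1 hQ h2N ha₂ ha₂' hαu hroot hν'
  -- the integer period functional
  have hΩ : plusPeriod D₀.f ≠ 0 := (IsNewform0.plusPeriod_pos_holds hf.1 hQ).ne'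
  choose m hm using SignedMuAtTwo.exists_int_re_cuspSymbol_eq D₀.f hΩ
  -- `b` is odd when `d` is even (`ad − bc = 1`)
  have hbodd_of : ∀ γ : Gamma0 (E₀.conductorNorm ℤ), (2 : ℤ) ∣ dEntry γ → Odd ((γ : SL(2, ℤ)) 0 1 : ℤ) := by
    intro γ hd2
    have hdet : ((γ : SL(2, ℤ)) 0 0 : ℤ) * (γ : SL(2, ℤ)) 1 1 - ((γ : SL(2, ℤ)) 0 1 : ℤ) * (γ : SL(2, ℤ)) 1 0 = 1 := by
      have := Matrix.SpecialLinearGroup.det_coe (γ : SL(2, ℤ))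
      rw [Matrix.det_fin_two] at this; linear_combination this
    change (2 : ℤ) ∣ (γ : SL(2, ℤ)) 1 1 at hd2
    by_contra hb
    rw [Int.not_odd_iff_even] at hb
    obtain ⟨u, hu⟩ := hd2; obtain ⟨v, hv⟩ := hb
    have h1 : (1 : ℤ) = 2 * (((γ : SL(2, ℤ)) 0 0 : ℤ) * u - v * (γ : SL(2, ℤ)) 1 0) := by
      linear_combination -hdet + ((γ : SL(2, ℤ)) 0 0 : ℤ) * hu - ((γ : SL(2, ℤ)) 1 0 : ℤ) * hv
    exact absurd (⟨((γ : SL(2, ℤ)) 0 0 : ℤ) * u - v * (γ : SL(2, ℤ)) 1 0, by linear_combination h1⟩ : Even (1 : ℤ))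
      Int.not_even_one
  -- flatness on the group elements with `|d| = 2ᵏ`
  have hflatG : ∀ (γ : Gamma0 (E₀.conductorNorm ℤ)) (k : ℕ), (dEntry γ).natAbs = 2 ^ k →
      ((m γ : ℤ) : ZMod (2 ^ (s + 1))) = (k : ZMod (2 ^ (s + 1))) * sl := by
    intro γ k hk
    have hd0 : dEntry γ ≠ 0 := by
      intro h0; rw [h0, Int.natAbs_zero] at hk; exact absurd hk (pow_ne_zero k two_ne_zero).symm
    have hdict := functional_eq_two_mul_ratPlusSymbol_sub hf.1 hQ hΩ hm γ hd0
    rcases Nat.eq_zero_or_pos k with rfl | hkpos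
    · -- `d = ±1`: the cusp `b/d` is an integer, `m γ = 0`
      have hd1 : dEntry γ = 1 ∨ dEntry γ = -1 := by
        rcases Int.natAbs_eq (dEntry γ) with h | h <;> rw [hk] at h <;> simp at h <;> tauto
      have hint : ∃ z : ℤ, ((((γ : SL(2, ℤ)) 0 1 : ℤ) : ℚ) / ((dEntry γ : ℤ) : ℚ)) = 0 + (z : ℚ) := by
        rcases hd1 with h | h
        · exact ⟨((γ : SL(2, ℤ)) 0 1 : ℤ), by rw [h]; push_cast; ring⟩
        · exact ⟨-((γ : SL(2, ℤ)) 0 1 : ℤ), by rw [h]; push_cast; ring⟩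
      obtain ⟨z, hz⟩ := hint
      have : (m γ : ℚ) = 0 := by rw [hdict, hz, ratPlusSymbol_add_intCast_eq]; ring
      have hm0 : m γ = 0 := by exact_mod_cast this
      rw [hm0]; simp
    · have hd2 : (2 : ℤ) ∣ dEntry γ := by
        have h : ((2 : ℕ) : ℤ) ∣ dEntry γ :=
          Int.natCast_dvd.mpr (by rw [hk]; exact dvd_pow_self 2 (by omega))
        exact_mod_cast h
      -- the cusp is `(ε b)/2^k` with `ε b` odd
      rcases Int.natAbs_eq (dEntry γ) with hε | hε <;> rw [hk] at hε
      · have hbodd := hbodd_of γ hd2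
        have heq : 2 * (ratPlusSymbol D₀.f ((((γ : SL(2, ℤ)) 0 1 : ℤ) : ℚ) / (2 : ℚ) ^ k) - ratPlusSymbol D₀.f 0) = m γ := by
          rw [hdict, hε]; push_cast; ring
        have h := hflat k _ hbodd (m γ) heq
        rw [h, nsmul_eq_mul]
      · have hbodd : Odd (-((γ : SL(2, ℤ)) 0 1 : ℤ)) := (hbodd_of γ hd2).neg
        have heq : 2 * (ratPlusSymbol D₀.f ((((-((γ : SL(2, ℤ)) 0 1 : ℤ)) : ℤ) : ℚ) / (2 : ℚ) ^ k) - ratPlusSymbol D₀.f 0) = m γ := by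
          rw [hdict, hε]; push_cast
          rw [show ((((γ : SL(2, ℤ)) 0 1 : ℤ) : ℚ)) / -(2 : ℚ) ^ k = -(((γ : SL(2, ℤ)) 0 1 : ℤ) : ℚ) / (2 : ℚ) ^ k by ring]
        have h := hflat k _ hbodd (m γ) heq
        rw [h, nsmul_eq_mul]
  -- S3: Eisenstein mod 2^{s+1}
  have hsl : addOrderOf sl ∣ 4 := addOrderOf_dvd_iff_nsmul_eq_zero.mpr h4sl
  have hspanP := conjSpanGen_two_pow_addOrderOf_of_dvd_four h2N (hspan _ hNodd).1 (hspan _ hNodd).2 sl hsl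
  obtain ⟨χ, hχ⟩ := exists_eisenstein_of_flat_functional D₀.f hm hΩ sl hflatG hspanP
  -- (β): descent
  exact S4 E₀ D₀ hopt hcm hr hgo hW₁ s m hm χ hχ

end Glue

end Summit.BirchSwinnertonDyer.BirchSwinnertonDyer.Theorems.AnalyticMuTwo

end
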